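import Mathlib
import Literature.NumberTheory.LFunctions.Zhang2022.PrimitiveCharOrthogonality
import HarnessLib

/-!
# Mean square of a bilinear character form over all characters to a prime modulus
# (orthogonality in mean square; the tool behind Zhang 2022 §15 u009/u011–u012 and §17 p. 96)

Topic `Literature/NumberTheory/LFunctions/Zhang2022` (Landau–Siegel audit tree; verdict-neutral).
Y. Zhang, *Discrete mean estimates and the Landau–Siegel zero*, arXiv:2211.02515v1 (2022)
[Zhang2022LandauSiegel] — an unrefereed manuscript under adjudication; nothing here asserts or denies its
Theorems 1–2. On p. 80–81 (proof of (15.4), nodes `Z22:§15.u009`–`u012`) the manuscript sums, over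
the characters `ψ (mod p)`, bilinear expressions `Σ_{m,n} c_{m,n} ψ̄(Dm)ψ(n)` ("`Σ*_{ψ (mod p)} ψ̄(Dm)ψ(n)`
… if `n ≠ Dm` … `≪ 1`", u011), and the extension `Ψ₁ → Ψ` of u009 ("in a way similar to the proof of
(7.3)") needs such sums in MEAN SQUARE over `ψ` (Cauchy–Schwarz against `#Ψ₂ ≪ 𝔓𝓛⁻⁷³⁹`, Prop. 2.1;
lane note HOME/INBOX 2026-08-27T01:1xZ). This file proves the orthogonality identity and bound that
make that step a finite computation, for an ARBITRARY finite family of coefficients: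

* `sum_normSq_bilinear_eq` — for a prime `p`, index set `S`, residues `a_i, b_i (mod p)` and complex
  `c_i`: `Σ_{ψ mod p} ‖Σ_{i∈S} c_i ψ̄(a_i)ψ(b_i)‖² = (p−1)·Σ_{i,j∈S, b_i a_j = a_i b_j ≠ 0} c_i c̄_j`
  (all characters, principal included; `ψ̄ = conj ∘ ψ`), from Mathlib's orthogonality relations through
  the tree's `PrimChar.sum_apply_mul_inv_apply`;
* `sum_norm_sq_bilinear_le` — hence `≤ (p−1)·Σ_{i,j∈S, a_j b_i = a_i b_j} ‖c_i‖‖c_j‖` (the "diagonal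
  congruence" majorant; any sub-family of characters, e.g. the primitive ones, is bounded by the same).

Theorems only; no definitions, no named facts. [cite: MontgomeryVaughan2007, §4.2 Cor. 4.5]

## References

* H. L. Montgomery, R. C. Vaughan, *Multiplicative Number Theory I* (2007), §4.2, Cor. 4.5
  (orthogonality relations). [cite: MontgomeryVaughan2007, §4.2 Cor. 4.5]
* Y. Zhang, arXiv:2211.02515v1 (2022), §15 pp. 80–81 (u009, u011). [cite: Zhang2022LandauSiegel, §15 p. 80]
-/

noncomputable section

open Complex ComplexConjugate Finset

namespace Literature.NumberTheory.LFunctions.Zhang2022.CharBilinear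

variable {p : ℕ} [Fact p.Prime]

/-- **Orthogonality in mean square for a bilinear character form (exact)**: for a prime `p`, a
finite index set `S`, residues `a_i, b_i (mod p)` and complex coefficients `c_i`,
`Σ_{ψ mod p} ‖Σ_{i∈S} c_i ψ̄(a_i)ψ(b_i)‖² = Σ_{i,j∈S} c_i c̄_j·(p−1)·[b_i a_j = a_i b_j ≠ 0]`
(as complex numbers). [cite: MontgomeryVaughan2007, §4.2 Cor. 4.5] -/
theorem sum_normSq_bilinear_eq {ι : Type*} (S : Finset ι) (a b : ι → ZMod p) (c : ι → ℂ) :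
    ((∑ ψ : DirichletCharacter ℂ p, ‖∑ i ∈ S, c i * conj (ψ (a i)) * ψ (b i)‖ ^ 2 : ℝ) : ℂ) =
      ∑ i ∈ S, ∑ j ∈ S, c i * conj (c j) *
        (if b i * a j = a i * b j ∧ a i * b j ≠ 0 then ((p : ℂ) - 1) else 0) := by
  classical
  -- `‖F‖² = F·conj F`
  have hsq : ∀ z : ℂ, ((‖z‖ : ℝ) : ℂ) ^ 2 = z * conj z := fun z => by
    rw [Complex.mul_conj, Complex.normSq_eq_norm_sq, Complex.ofReal_pow]
  push_cast
  simp_rw [hsq]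
  -- expand the product of the two sums
  have hexp : ∀ ψ : DirichletCharacter ℂ p,
      (∑ i ∈ S, c i * conj (ψ (a i)) * ψ (b i)) * conj (∑ j ∈ S, c j * conj (ψ (a j)) * ψ (b j)) =
        ∑ i ∈ S, ∑ j ∈ S, c i * conj (c j) * (ψ (b i * a j) * ψ⁻¹ (a i * b j)) := by
    intro ψ
    rw [map_sum, Finset.sum_mul_sum]
    refine Finset.sum_congr rfl fun i _ => Finset.sum_congr rfl fun j _ => ?_
    rw [map_mul, map_mul, Complex.conj_conj, PrimChar.inv_apply_eq_conj, map_mul, map_mul, map_mul]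
    ring
  simp_rw [hexp]
  rw [Finset.sum_comm]
  refine Finset.sum_congr rfl fun i _ => ?_
  rw [Finset.sum_comm]
  refine Finset.sum_congr rfl fun j _ => ?_
  rw [← Finset.mul_sum, PrimChar.sum_apply_mul_inv_apply]

/-- **Orthogonality in mean square, majorant form**: with the notation of `sum_normSq_bilinear_eq`,
`Σ_{ψ mod p} ‖Σ_{i∈S} c_i ψ̄(a_i)ψ(b_i)‖² ≤ (p−1)·Σ_{i,j∈S, b_i a_j = a_i b_j} ‖c_i‖‖c_j‖` — only the
"diagonal congruence" pairs survive the average over `ψ`. [cite: MontgomeryVaughan2007, §4.2 Cor. 4.5] -/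
theorem sum_norm_sq_bilinear_le {ι : Type*} (S : Finset ι) (a b : ι → ZMod p) (c : ι → ℂ) :
    ∑ ψ : DirichletCharacter ℂ p, ‖∑ i ∈ S, c i * conj (ψ (a i)) * ψ (b i)‖ ^ 2 ≤
      ((p : ℝ) - 1) * ∑ i ∈ S, ∑ j ∈ S, if b i * a j = a i * b j then ‖c i‖ * ‖c j‖ else 0 := by
  classical
  have hp1 : (1 : ℝ) ≤ p := by exact_mod_cast (Fact.out : p.Prime).one_lt.le
  have key := sum_normSq_bilinear_eq S a b c
  -- take norms of the complex identity
  have hL : ∑ ψ : DirichletCharacter ℂ p, ‖∑ i ∈ S, c i * conj (ψ (a i)) * ψ (b i)‖ ^ 2 =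
      ‖((∑ ψ : DirichletCharacter ℂ p, ‖∑ i ∈ S, c i * conj (ψ (a i)) * ψ (b i)‖ ^ 2 : ℝ) : ℂ)‖ := by
    rw [Complex.norm_real, Real.norm_of_nonneg (Finset.sum_nonneg fun ψ _ => by positivity)]
  rw [hL, key]
  refine (norm_sum_le _ _).trans ?_
  rw [Finset.mul_sum]
  refine Finset.sum_le_sum fun i _ => ?_
  refine (norm_sum_le _ _).trans ?_
  rw [Finset.mul_sum]
  refine Finset.sum_le_sum fun j _ => ?_
  by_cases h : b i * a j = a i * b j
  · rw [if_pos h]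
    by_cases h0 : a i * b j ≠ 0
    · rw [if_pos ⟨h, h0⟩, norm_mul, norm_mul, Complex.norm_conj,
        show ‖((p : ℂ) - 1)‖ = (p : ℝ) - 1 by
          rw [show ((p : ℂ) - 1) = (((p : ℝ) - 1 : ℝ) : ℂ) by push_cast; ring, Complex.norm_real,
            Real.norm_of_nonneg (by linarith)]]
      exact le_of_eq (by ring)
    · rw [if_neg (fun hh => h0 hh.2), mul_zero, norm_zero]
      exact mul_nonneg (by linarith) (mul_nonneg (norm_nonneg _) (norm_nonneg _))
  · rw [if_neg (fun hh => h hh.1), if_neg h, mul_zero, norm_zero, mul_zero]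

end Literature.NumberTheory.LFunctions.Zhang2022.CharBilinear
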